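import Mathlib
import Literature.Computability.AlgebraicComplexity.RectangularExponent
import Literature.Computability.AlgebraicComplexity.RectangularExponentBounds
import Literature.Computability.AlgebraicComplexity.RectangularExponentHomogeneity
import Literature.Computability.AlgebraicComplexity.RectangularExponentAsymptoticRank
import Literature.Computability.AlgebraicComplexity.FlatteningBound
import Literature.Computability.AlgebraicComplexity.KroneckerRank

/-!
# MatrixMultiplication / ShapeSubmodularity — `ShapeSubmodular`, the ray `(1,1,c)` is sandwichable

Route `ShapeSubmodularity`, crux `ShapeSubmodular` (stmt-MatrixMultiplication-15622), line
`registered` (RESHAPE 5), stub `stub_sandwichRay11`.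

Write `R⟨k, m, l⟩ = tensorRank (matMulTensor ℂ k m l)`.  The unit cell with meet `(1,1,c)`,
hypothesis formats `(2,1,c)`, `(1,2,c)` and join `(2,2,c)` is *sandwichable* when the join and the
meet admit exponents `u`, `u'` (`R⟨n^2, n^2, n^c⟩ = O(n^u)`, `R⟨n, n, n^c⟩ = O(n^{u'})`) with
`u + u' ≤ L(2,1,c) + L(1,2,c) = 2(c + 2)` (`c ≥ 2`, `L` the flattening value `sum - min`).

This file proves that the whole ray `(1,1,c)`, `c ≥ 2`, is sandwichable, CONDITIONALLY on the named
fact `advxxz2025_omegaRect_table` (Alman–Duan–Vassilevska Williams–Xu–Xu–Zhou, SODA 2025, Table 1;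
unproved in tree, taken as an explicit hypothesis): its rows `k = 1` (`ω ≤ 2.371339`) and `k = 2`
(`ω(1,2,1) ≤ 3.250035`) give `2 · 2.371339 + 3.250035 = 7.992713 ≤ 8`.

Proof (`δ = 0.002`).  The infimum `ω(1,1,q) = inf (rectAdmissibleExponents ℂ 1 1 q)` being
`≤ b` makes `b + δ` admissible (`exists_lt_of_csInf_lt`, upward closure), i.e.
`R⟨n, n, n^q⟩ = O(n^{b+δ})` (`rectDim_one`, `rectDim_natCast`); with `q = 1`, `b = 2.371339`
(`ω(1,1,1) = ω`) along the subsequence `m = n²` this is `R⟨n², n², n²⟩ = O(n^{2(2.371339+δ)})`, and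
with `q = 2`, `b = 3.250035` (`ω(1,2,1) = ω(1,1,2)`) it is `R⟨n, n, n²⟩ = O(n^{3.250035+δ})`.
Finally, for `c = 2 + d`, BLOCKING the last dimension, `R⟨k, m, n² · n^d⟩ ≤ n^d · R⟨k, m, n²⟩`
(Kronecker product with `⟨1, 1, n^d⟩` of rank `≤ n^d`; Bläser 2013, Lemma 5.8 and p. 24), gives
`u = 2(2.371339 + δ) + d` and `u' = 3.250035 + δ + d`, `u + u' = 2d + 7.998713 ≤ 2(c + 2)`.
-/

-- (single-conjunct summit: the namespace repeats MatrixMultiplication)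
set_option linter.dupNamespace false

namespace Summit.MatrixMultiplication.MatrixMultiplication.Theorems.ShapeSubmodular

open Filter Asymptotics
open Literature.Computability.AlgebraicComplexity

/-! ## `O`-bookkeeping for `ℕ`-valued sequences against real powers `n ↦ n^β` -/

/-- Extra factors of `n`: if `R' n ≤ n^d · R n` and `R = O(n^β)`, then `R' = O(n^{β+d})`.
[folklore] -/
private theorem ray11_isBigO_mul_pow (R R' : ℕ → ℕ) (β : ℝ) (d : ℕ)
    (h : ∀ n : ℕ, R' n ≤ n ^ d * R n)
    (hO : (fun n : ℕ => (R n : ℝ)) =O[atTop] (fun n : ℕ => (n : ℝ) ^ β)) :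
    (fun n : ℕ => (R' n : ℝ)) =O[atTop] (fun n : ℕ => (n : ℝ) ^ (β + d)) := by
  -- adapted from `Theorems.ShapeSubmodular.cell_isBigO_mul` (stub_cellOfFlatMeet)
  have h1 : (fun n : ℕ => (R' n : ℝ)) =O[atTop] (fun n : ℕ => (n : ℝ) ^ d * (R n : ℝ)) := by
    refine IsBigO.of_bound 1 (Eventually.of_forall fun n => ?_)
    rw [one_mul, Real.norm_of_nonneg (Nat.cast_nonneg _), Real.norm_of_nonneg (by positivity)]
    exact_mod_cast h n
  have h2 : (fun n : ℕ => (n : ℝ) ^ d * (R n : ℝ)) =O[atTop]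
      (fun n : ℕ => (n : ℝ) ^ d * (n : ℝ) ^ β) :=
    (isBigO_refl _ _).mul hO
  have h3 : (fun n : ℕ => (n : ℝ) ^ d * (n : ℝ) ^ β) =ᶠ[atTop]
      (fun n : ℕ => (n : ℝ) ^ (β + d)) := by
    filter_upwards [eventually_gt_atTop 0] with n hn0
    rw [Real.rpow_add_natCast (Nat.cast_pos.2 hn0).ne', mul_comm]
  exact (h1.trans h2).trans h3.isBigO

/-- Passing to the subsequence `m = n^t`: if `R m = O(m^β)` then `R (n^t) = O(n^{tβ})`.
[folklore] -/
private theorem ray11_isBigO_comp_pow (R : ℕ → ℕ) (β : ℝ) (t : ℕ) (ht : t ≠ 0)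
    (hO : (fun m : ℕ => (R m : ℝ)) =O[atTop] (fun m : ℕ => (m : ℝ) ^ β)) :
    (fun n : ℕ => (R (n ^ t) : ℝ)) =O[atTop] (fun n : ℕ => (n : ℝ) ^ ((t : ℝ) * β)) := by
  -- adapted from the proof of `mul_mem_rectAdmissibleExponents_smul`
  -- (Literature/RectangularExponentHomogeneity)
  refine (hO.comp_tendsto (tendsto_pow_atTop ht)).congr (fun _ => rfl) fun n => ?_
  show (((n ^ t : ℕ) : ℝ)) ^ β = (n : ℝ) ^ ((t : ℝ) * β)
  push_cast
  rw [Real.rpow_natCast_mul (Nat.cast_nonneg _)]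

/-! ## From `ω(1, 1, q) ≤ b` to a rank bound, and blocking -/

/-- **`ω(1,1,q) ≤ b` gives `R⟨n, n, n^q⟩ = O(n^{b+δ})` for every `δ > 0`** (`q` natural): the
infimum `ω(1,1,q)` of the admissible exponents of `⟨⌈n^1⌉, ⌈n^1⌉, ⌈n^q⌉⟩ = ⟨n, n, n^q⟩` is
`< b + δ`, so some admissible exponent is, and the admissible exponents are upward closed.
[folklore] -/
private theorem ray11_isBigO_of_omegaRect_le {q : ℕ} {b δ : ℝ}
    (hb : omegaRect ℂ 1 1 (q : ℝ) ≤ b) (hδ : 0 < δ) :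
    (fun n : ℕ => (tensorRank (matMulTensor ℂ n n (n ^ q)) : ℝ)) =O[atTop]
      fun n : ℕ => (n : ℝ) ^ (b + δ) := by
  -- adapted from `Theorems.ShapeSubmodular.flat_isBigO_square` (stub_flatValue)
  have hinf : sInf (rectAdmissibleExponents ℂ 1 1 (q : ℝ)) < b + δ := by
    unfold omegaRect at hb
    linarith
  obtain ⟨β, hβ, hβlt⟩ := exists_lt_of_csInf_lt (rectAdmissibleExponents_nonempty ℂ _ _ _) hinf
  have hmem := mem_rectAdmissibleExponents_of_le hβ hβlt.le
  have e : (fun n : ℕ =>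
      (tensorRank (matMulTensor ℂ (rectDim n 1) (rectDim n 1) (rectDim n (q : ℝ))) : ℝ)) =
      fun n : ℕ => (tensorRank (matMulTensor ℂ n n (n ^ q)) : ℝ) :=
    funext fun n => by
      rw [tensorRank_matMulTensor_congr ℂ (rectDim_one n) (rectDim_one n) (rectDim_natCast n q)]
  rw [← e]
  exact hmem

/-- Blocking in the last dimension: `R⟨k, m, l·t⟩ ≤ t · R⟨k, m, l⟩` (Kronecker product with
`⟨1, 1, t⟩`, whose rank is `≤ t` by the standard algorithm).
[cite: Blaser2013, Lemma 5.8 and p. 24] -/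
private theorem ray11_rank_mul_right_le (k m l t : ℕ) :
    tensorRank (matMulTensor ℂ k m (l * t)) ≤ t * tensorRank (matMulTensor ℂ k m l) := by
  -- adapted from `Theorems.ShapeSubmodular.cell_rank_mul_mid_le` (stub_cellOfFlatMeet)
  have h := Blaser2013_rank_matMulTensor_mul_le ℂ k m l 1 1 t
  rw [mul_one k, mul_one m] at h
  calc tensorRank (matMulTensor ℂ k m (l * t))
        ≤ tensorRank (matMulTensor ℂ k m l) * tensorRank (matMulTensor ℂ 1 1 t) := h
    _ ≤ tensorRank (matMulTensor ℂ k m l) * t := by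
        refine Nat.mul_le_mul_left _ ?_
        simpa using tensorRank_matMulTensor_le ℂ 1 1 t
    _ = t * tensorRank (matMulTensor ℂ k m l) := mul_comm _ _

/-! ## The stub -/

/-- **The ray `(1,1,c)`, `c ≥ 2`, is sandwichable** (stub `stub_sandwichRay11` of the line
`registered` of crux `ShapeSubmodular`), conditionally on the 2025 rectangular table
`advxxz2025_omegaRect_table` (hypothesis): there are exponents `u` for the join
`R⟨n^2, n^2, n^c⟩ = O(n^u)` and `u'` for the meet `R⟨n^1, n^1, n^c⟩ = O(n^{u'})` with
`u + u' ≤ 2(c + 2)`.  From the rows `ω ≤ 2.371339` and `ω(1,2,1) ≤ 3.250035`: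
`R⟨n², n², n²⟩ = O(n^{2(2.371339+δ)})` (subsequence `m = n²` of the square bound),
`R⟨n, n, n²⟩ = O(n^{3.250035+δ})` (`ω(1,2,1) = ω(1,1,2)`), and blocking the last dimension by
`n^{c-2}` (`Blaser2013_rank_matMulTensor_mul_le`, `tensorRank_matMulTensor_le`);
`2 · 2.371339 + 3.250035 + 3δ = 7.998713 ≤ 8` for `δ = 0.002`. [folklore] -/
theorem stub_sandwichRay11 :
    Literature.Computability.AlgebraicComplexity.advxxz2025_omegaRect_table →
    ∀ c : ℕ, 2 ≤ c →
      ∃ u u' : ℝ, u + u' ≤ 2 * ((c : ℝ) + 2) ∧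
        (fun n : ℕ => (Literature.Computability.AlgebraicComplexity.tensorRank
          (Literature.Computability.AlgebraicComplexity.matMulTensor ℂ (n ^ 2) (n ^ 2) (n ^ c)) : ℝ))
            =O[Filter.atTop] (fun n : ℕ => (n : ℝ) ^ u) ∧
        (fun n : ℕ => (Literature.Computability.AlgebraicComplexity.tensorRank
          (Literature.Computability.AlgebraicComplexity.matMulTensor ℂ (n ^ 1) (n ^ 1) (n ^ c)) : ℝ))
            =O[Filter.atTop] (fun n : ℕ => (n : ℝ) ^ u') := by
  intro h c hc
  -- `c = 2 + d`
  obtain ⟨d, rfl⟩ := Nat.exists_eq_add_of_le hc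
  -- the two rows of the 2025 table, in the `(1, 1, q)` placement
  have hω : omegaRect ℂ 1 1 ((1 : ℕ) : ℝ) ≤ 2.371339 := by
    rw [Nat.cast_one, omegaRect_one_one_one]
    exact h.omega_le
  have h12 : omegaRect ℂ 1 1 ((2 : ℕ) : ℝ) ≤ 3.250035 := by
    rw [Nat.cast_ofNat, ← omegaRect_one_mid_one]
    exact h.one_two_one
  have hδ : (0 : ℝ) < 0.002 := by norm_num
  -- `R⟨m, m, m⟩ = O(m^{2.371339+δ})` along `m = n²`: `R⟨n², n², n²⟩ = O(n^{2(2.371339+δ)})`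
  have h222 := ray11_isBigO_comp_pow (fun m : ℕ => tensorRank (matMulTensor ℂ m m (m ^ 1))) _ 2
    two_ne_zero (ray11_isBigO_of_omegaRect_le hω hδ)
  -- `R⟨n, n, n²⟩ = O(n^{3.250035+δ})`
  have h112 := ray11_isBigO_of_omegaRect_le h12 hδ
  -- blocking the last dimension by `n^d`
  have hjoin : (fun n : ℕ => (tensorRank (matMulTensor ℂ (n ^ 2) (n ^ 2) (n ^ (2 + d))) : ℝ))
      =O[atTop] fun n : ℕ => (n : ℝ) ^ (((2 : ℕ) : ℝ) * (2.371339 + 0.002) + d) := by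
    refine ray11_isBigO_mul_pow
      (fun n : ℕ => tensorRank (matMulTensor ℂ (n ^ 2) (n ^ 2) ((n ^ 2) ^ 1))) _ _ d (fun n => ?_)
      h222
    calc tensorRank (matMulTensor ℂ (n ^ 2) (n ^ 2) (n ^ (2 + d)))
          = tensorRank (matMulTensor ℂ (n ^ 2) (n ^ 2) ((n ^ 2) ^ 1 * n ^ d)) :=
        tensorRank_matMulTensor_congr ℂ rfl rfl (by rw [pow_one, pow_add])
      _ ≤ n ^ d * tensorRank (matMulTensor ℂ (n ^ 2) (n ^ 2) ((n ^ 2) ^ 1)) :=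
        ray11_rank_mul_right_le _ _ _ _
  have hmeet : (fun n : ℕ => (tensorRank (matMulTensor ℂ (n ^ 1) (n ^ 1) (n ^ (2 + d))) : ℝ))
      =O[atTop] fun n : ℕ => (n : ℝ) ^ ((3.250035 : ℝ) + 0.002 + d) := by
    refine ray11_isBigO_mul_pow (fun n : ℕ => tensorRank (matMulTensor ℂ n n (n ^ 2)))
      _ _ d (fun n => ?_) h112
    calc tensorRank (matMulTensor ℂ (n ^ 1) (n ^ 1) (n ^ (2 + d)))
          = tensorRank (matMulTensor ℂ n n (n ^ 2 * n ^ d)) :=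
        tensorRank_matMulTensor_congr ℂ (pow_one n) (pow_one n) (pow_add n 2 d)
      _ ≤ n ^ d * tensorRank (matMulTensor ℂ n n (n ^ 2)) := ray11_rank_mul_right_le _ _ _ _
  refine ⟨_, _, ?_, hjoin, hmeet⟩
  push_cast
  linarith

end Summit.MatrixMultiplication.MatrixMultiplication.Theorems.ShapeSubmodular
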